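import Summits.ResolutionOfSingularities.ResolutionOfSingularities.Theorems.ProximityCutClasses
import HarnessLib

/-!
# ProximityCutKernels — the proximity cut of the deep E-format walk column: kernels (lens §3, all PROVED)
(lens-3 g12 node «ProximityCut» rev 3a (sha256 3a2d1668… = rev 3 e1d6297007058045 + lint fix :1743);
CRITIC-LEDGER rows 79 / 83 / 84 (CLEARED, CLEARED-REV, CLEARED-REV3))

[WRITER NOTE (decomp-res writer g5).  Lens §3 (:386–:517) VERBATIM except: (1) the by-name corollary
`defectWalksDeep_iff_prox` on the route item `MaxContactCut.DefectWalksDeep` (31770) is filed in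
`MaxContactCutProximityCut` (Theses cone); (2) lens `satDeep_of_defect` / `bare_of_defect` are NOT restated — they are
the landed `BoundaryLedger.satDeep_of_deep` / `BoundaryLedger.bare_of_deep` (same statements; cited); (3) critic (R1):
the hypothesis `hR : FreeTailsAreCriticalDeep` of the headline `defectDeep_iff_four` is DISCHARGED by the landed
`BoundaryLedger.freeTailsAreCriticalDeep_holds` (g11's PROVED rigidity), so `defectDeep_iff_four` is now unconditional:
`DefectWalksTerminateDeep ⟺ NoFreePointTailsDeep ∧ NoBareTailsDeep ∧ SatDefectWalksTerminateDeep` (EXACT, PROVED) —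
31770 ≡ arc law [DECIDED desk, prover target `ArcLawPort`] ∧ g11's bare line [KNOWN-MOD-PORT CJS2020 Cor. 5.37] ∧ g11's
satellite column [open].  0 sorry.] (Sources: Hauser2010 Lecture IX; CossartJannsenSaito2020 Cor. 5.37.)
-/

open MvPolynomial
open Literature.AlgebraicGeometry.Resolution
open Literature.AlgebraicGeometry.Resolution.Hauser2010
open Literature.AlgebraicGeometry.Resolution.PointBlowup
open Summit.ResolutionOfSingularities.ResolutionOfSingularities.Theorems.TightDefectClasses
open Summit.ResolutionOfSingularities.ResolutionOfSingularities.Theorems.TightDefectStrongWalks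
open Summit.ResolutionOfSingularities.ResolutionOfSingularities.Theorems.ItineraryCutClasses
open Summit.ResolutionOfSingularities.ResolutionOfSingularities.Theorems.BoundaryLedger

namespace Summit.ResolutionOfSingularities.ResolutionOfSingularities.Theorems.ProximityCut

/-! ## §3 Kernels (all PROVED) -/

/-- Necessity of the deep arc law (instantiation). [folklore] -/
theorem freeTailsDeep_of_defect (h : DefectWalksTerminateDeep) : NoFreePointTailsDeep :=
  fun p hp e he K _ _ _ _ s₀ hs W hW _ _ => h p hp e he K s₀ hs W hW

/-- Necessity of the residual (instantiation). [folklore] -/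
theorem recurrentDeep_of_defect (h : DefectWalksTerminateDeep) : NoRecurrentProximityDeep :=
  fun p hp e he K _ _ _ _ s₀ hs W hW _ => h p hp e he K s₀ hs W hW

/-- The deep column of the arc law is an instance of the all-`e` arc law. [folklore] -/
theorem freeTailsDeep_of_all (h : NoFreePointTails) : NoFreePointTailsDeep :=
  fun p hp e he K _ _ _ _ s₀ hs W _ N hN => h p hp e (by omega) K s₀ hs W N hN

/-- Sufficiency: the two pieces give the blocker (the proximity dichotomy). [folklore] -/
theorem defectDeep_of_prox (h₁ : NoFreePointTailsDeep) (h₂ : NoRecurrentProximityDeep) :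
    DefectWalksTerminateDeep := by
  intro p hp e he K _ _ _ _ s₀ hs W hW
  rcases eventually_leaves_or_recurrent_stays W with ⟨N, hN⟩ | hR
  · exact h₁ p hp e he K s₀ hs W hW N hN
  · exact h₂ p hp e he K s₀ hs W hW hR

/-- **THE PROXIMITY CUT (EXACT, PROVED).** [folklore] -/
theorem defectDeep_iff_prox :
    DefectWalksTerminateDeep ↔ NoFreePointTailsDeep ∧ NoRecurrentProximityDeep :=
  ⟨fun h => ⟨freeTailsDeep_of_defect h, recurrentDeep_of_defect h⟩, fun h => defectDeep_of_prox h.1 h.2⟩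

/-- Given the (decided) arc law, the blocker IS the residual. [folklore] -/
theorem defectDeep_iff_residual (hA : NoFreePointTails) :
    DefectWalksTerminateDeep ↔ NoRecurrentProximityDeep :=
  ⟨recurrentDeep_of_defect, fun h => defectDeep_of_prox (freeTailsDeep_of_all hA) h⟩

/-- The all-`e` column: `WalksTerminate ⟺ arc law ∧ no recurrent proximity` (EXACT, PROVED). [folklore] -/
theorem walks_iff_prox : WalksTerminate ↔ NoFreePointTails ∧ NoRecurrentProximity := by
  refine ⟨fun h => ⟨fun p hp e he K _ _ _ _ s₀ hs W _ _ => h p hp e he K s₀ hs W,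
    fun p hp e he K _ _ _ _ s₀ hs W _ => h p hp e he K s₀ hs W⟩, fun ⟨h₁, h₂⟩ => ?_⟩
  intro p hp e he K _ _ _ _ s₀ hs W
  rcases eventually_leaves_or_recurrent_stays W with ⟨N, hN⟩ | hR
  · exact h₁ p hp e he K s₀ hs W N hN
  · exact h₂ p hp e he K s₀ hs W hR

/-- **g11's LOADED LINE LIES INSIDE THE ARC LAW (PROVED).**  In a loaded satellite-free plateau every move is
newest-free (`leavesNewest_of_free_loaded`), so the deep arc law kills it. [folklore] -/
theorem loaded_of_freeTails (h : NoFreePointTailsDeep) : NoLoadedCriticalPlateauxDeep := by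
  intro p hp e he K _ _ _ _ s₀ hs W hW N ρ hρ hN
  refine h p hp e he K s₀ hs W hW N fun t ht => ?_
  have h0 := (hN t ht).1
  have h1 := (hN (t + 1) (by omega)).1
  have h2 : 1 ≤ (W.st (t + 1)).r.degree := by rw [(hN (t + 1) (by omega)).2.2]; exact hρ
  exact leavesNewest_of_free_loaded W t h0 h1 h2

/-- Necessity of the massless line (instantiation). [folklore] -/
theorem massless_of_recurrent (h : NoRecurrentProximityDeep) : NoMasslessProximityLineDeep :=
  fun p hp e he K _ _ _ _ s₀ hs W hW _ hR => h p hp e he K s₀ hs W hW hR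

/-- The residual splits along g11's satellite column (PROVED: finitely or infinitely many satellite moves). [folklore] -/
theorem recurrent_of_sat_massless (h₁ : SatDefectWalksTerminateDeep) (h₂ : NoMasslessProximityLineDeep) :
    NoRecurrentProximityDeep := by
  intro p hp e he K _ _ _ _ s₀ hs W hW hR
  by_cases hsat : ∀ N : ℕ, ∃ i, N ≤ i ∧ W.Satellite i
  · exact h₁ p hp e he K s₀ hs W hW hsat
  · push Not at hsat
    obtain ⟨N, hN⟩ := hsat
    exact h₂ p hp e he K s₀ hs W hW ⟨N, hN⟩ hR

/-- **THE THREE-PIECE CUT (EXACT, PROVED):** blocker ⟺ arc law ∧ g11's satellite column ∧ the massless proximity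
line — after the (decided) arc law, the open part of 31770 is g11's satellite column plus ONE located line. [folklore] -/
theorem defectDeep_iff_three :
    DefectWalksTerminateDeep ↔
      NoFreePointTailsDeep ∧ SatDefectWalksTerminateDeep ∧ NoMasslessProximityLineDeep :=
  ⟨fun h => ⟨freeTailsDeep_of_defect h, BoundaryLedger.satDeep_of_deep h,
      massless_of_recurrent (recurrentDeep_of_defect h)⟩,
    fun h => defectDeep_of_prox h.1 (recurrent_of_sat_massless h.2.1 h.2.2)⟩

/-- In the massless line every late repeat follows a state of order exactly `q` (PROVED pointwise law, exported
for the census ask T-prox). [folklore] -/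
theorem massless_line_law {K : Type} [Field K] [DecidableEq K] {q : ℕ} {s₀ : State (Fin 3) K} (hs : IsRoot q s₀)
    (W : ForcedWalk q s₀) {N : ℕ} (hN : ∀ t, N ≤ t → ¬ W.Satellite t) {t : ℕ} (ht : N ≤ t)
    (hS : StaysOnNewest W t) : ordZero (W.st t).F = (q : ℕ∞) :=
  order_eq_of_stays_not_satellite hs W t hS (hN (t + 1) (by omega))

/-- **THE MASSLESS LINE IS BARE (PROVED modulo g11's PROVED rigidity, used by statement).**  In an eventually free
deep walk ONE late proximity repeat forces the critical plateau to be BARE: the repeat is massless (`o_t = q`), the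
plateau has shade `q = o_t − ρ`, so `ρ = 0`, i.e. `r_t = 0` and `o_t = q` for all large `t` — g11's bare line.
[folklore] -/
theorem massless_of_rigid_bare (hR : FreeTailsAreCriticalDeep) (hB : NoBareTailsDeep) :
    NoMasslessProximityLineDeep := by
  intro p hp e he K _ _ _ _ s₀ hs W hW hfree hrec
  obtain ⟨N, hN⟩ := hfree
  obtain ⟨N', ρ, hρ, hplat⟩ := hR p hp e he K s₀ hs W ⟨N, hN⟩
  obtain ⟨t, ht, hS⟩ := hrec (N + N')
  have ho : ordZero (W.st t).F = ((p ^ e : ℕ) : ℕ∞) := massless_line_law hs W hN (by omega) hS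
  have hst := hplat t (by omega)
  have hρ0 : ρ = 0 := by
    have h1 : (W.st t).shade = ((p ^ e : ℕ) : ℕ∞) := hst.1
    unfold State.shade at h1
    rw [ho, hst.2, ← ENat.coe_sub, Nat.cast_inj] at h1
    omega
  refine hB p hp e he K s₀ hs W hW N' fun t' ht' => ?_
  have hst' := hplat t' ht'
  have hr0 : (W.st t').r = 0 := by
    have h0 : (W.st t').r.degree = 0 := by rw [hst'.2, hρ0]
    exact (Finsupp.degree_eq_zero_iff _).mp h0
  refine ⟨hr0, ?_⟩
  have h1 := hst'.1
  unfold State.shade at h1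
  rwa [hr0, map_zero, Nat.cast_zero, tsub_zero] at h1

/-- **THE LOCATED RESIDUAL OF 31770 AFTER g11 + g12 (EXACT modulo g11's PROVED rigidity):** the blocker is the arc
law [DECIDED, desk] ∧ g11's bare line [KNOWN-MOD-PORT CJS2020 Cor. 5.37] ∧ g11's SATELLITE COLUMN — the one open,
un-ported class left in the deep E-format column is «infinitely many satellite moves». [folklore] -/
theorem defectDeep_iff_four :
    DefectWalksTerminateDeep ↔ NoFreePointTailsDeep ∧ NoBareTailsDeep ∧ SatDefectWalksTerminateDeep :=
  ⟨fun h => ⟨freeTailsDeep_of_defect h, BoundaryLedger.bare_of_deep h, BoundaryLedger.satDeep_of_deep h⟩,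
    fun h => defectDeep_iff_three.mpr
      ⟨h.1, h.2.2, massless_of_rigid_bare BoundaryLedger.freeTailsAreCriticalDeep_holds h.2.1⟩⟩

/-- The axis case sits inside the arc law (PROVED, one line). [folklore] -/
theorem axis_of_freeTails (h : NoFreePointTails) : NoAxisTails :=
  fun p hp e he K _ _ _ _ s₀ hs W N j hN =>
    h p hp e he K s₀ hs W N fun t ht => leavesNewest_of_chart_eq W t (by rw [(hN (t + 1) (by omega)).1, (hN t ht).1])

end Summit.ResolutionOfSingularities.ResolutionOfSingularities.Theorems.ProximityCut
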